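import Summits.Ventures.CertifiedQuantumChemistry.Rows.CARNormalOrder
import Literature.MathematicalPhysics.QuantumLattice.HubbardWave0LiebProofs
import HarnessLib

/-!
# Ventures/CertifiedQuantumChemistry — Rows/CARNormalOrderSound.lean: the normal-ordering engine is SOUND
# (part 2 of `Rows/CARNormalOrder.lean`: semantics in the tree's Jordan–Wigner matrices and the soundness theorems)

HONEST FRAMING (verbatim): certified bounds for a stated model Hamiltonian in a stated basis; not a
claim about the real molecule beyond that model.

var-2 (gen 17), zero compute, PROVED glue only (0 sorry, no claim node, no model, NO BOUND ASSERTED).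

* semantics `wmap`, `evalMono d`, `evalPoly d` of the syntax of `Rows/CARNormalOrder.lean` through a letter map
  `d : α → ι` into the orbital type of `Literature/…/QuantumLattice` (`ladderWord`, `creation`, `annihilation`); only
  INJECTIVITY of `d` is ever used (the contraction `a_x a†_c = δ − a†_c a_x` is decided on letters);
* **`re_quadForm_evalPoly_ge`**: for every polynomial `P` and vector `v`,
  `lowerConst P · Re⟨v,v⟩ ≤ Re ⟨v, evalPoly d P v⟩` — every ladder word is a contraction (`isContraction_prod_ladder`,
  `IsContraction.neg_norm_mul_le`), the unit monomial is the identity;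
* soundness of every engine step: `evalPoly_prependCre`, `evalPoly_insAnn`, `evalPoly_prependAnn` (CAR:
  `creation_mul_creation_eq_neg`, `creation_mul_self`, `annihilation_mul_creation`, `LiebThm1.annihilation_mul_self`,
  `LiebThm1.annihilation_mul_annihilation_eq_neg`),
  `evalPoly_prependLetter(Poly)`, **`evalPoly_wordToPoly`** (`= ladderWord`), **`evalPoly_termsToPoly`**
  (`= Σ_t c_t • ladderWord w_t`), `evalPoly_mergeAdj`, **`evalPoly_collect`** (a permutation + merging + dropping zeros do not
  change the operator — no property of the sort or of the key is needed), **`evalPoly_normalize`**.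

References: as in part 1 (Bratteli–Robinson II §5.2.2; Helgaker–Jørgensen–Olsen §1.8).
-/

namespace Summit.Ventures.CertifiedQuantumChemistry

open Matrix
open Literature.MathematicalPhysics.QuantumLattice

namespace CARPoly

/-! ## Semantics -/

section Semantics

variable {α : Type*} {ι : Type*} [LinearOrder ι] [Fintype ι]

/-- A letter map `d : α → ι` applied to a word. -/
def wmap (d : α → ι) (w : List (α × Bool)) : List (ι × Bool) := w.map fun l => (d l.1, l.2)

/-- The operator a monomial denotes (a ladder word of the tree). -/
noncomputable def evalMono (d : α → ι) (m : Mono α) : Matrix (Finset ι) (Finset ι) ℂ := ladderWord (wmap d m.word)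

/-- The operator a polynomial denotes. -/
noncomputable def evalPoly (d : α → ι) (P : Poly α) : Matrix (Finset ι) (Finset ι) ℂ :=
  (P.map fun mq => ((mq.2 : ℚ) : ℂ) • evalMono d mq.1).sum

omit [LinearOrder ι] [Fintype ι] in
/-- `wmap` of the empty word. -/
@[simp] theorem wmap_nil (d : α → ι) : wmap d [] = [] := rfl

omit [LinearOrder ι] [Fintype ι] in
/-- `wmap` of a cons. -/
@[simp] theorem wmap_cons (d : α → ι) (l : α × Bool) (w : List (α × Bool)) :
    wmap d (l :: w) = (d l.1, l.2) :: wmap d w := rfl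

omit [LinearOrder ι] [Fintype ι] in
/-- `wmap` of a concatenation. -/
theorem wmap_append (d : α → ι) (w w' : List (α × Bool)) : wmap d (w ++ w') = wmap d w ++ wmap d w' := by
  simp [wmap]

/-- The empty polynomial denotes `0`. -/
@[simp] theorem evalPoly_nil (d : α → ι) : evalPoly d ([] : Poly α) = 0 := rfl

/-- `evalPoly` of a cons. -/
theorem evalPoly_cons (d : α → ι) (mq : Mono α × ℚ) (P : Poly α) :
    evalPoly d (mq :: P) = ((mq.2 : ℚ) : ℂ) • evalMono d mq.1 + evalPoly d P := rfl

/-- `evalPoly` is additive under concatenation. -/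
theorem evalPoly_append (d : α → ι) (P Q : Poly α) : evalPoly d (P ++ Q) = evalPoly d P + evalPoly d Q := by
  simp [evalPoly, List.map_append, List.sum_append]

/-- The unit monomial denotes the identity. -/
theorem evalMono_unit (d : α → ι) : evalMono d (Mono.unit : Mono α) = 1 := by
  simp [evalMono, Mono.unit, Mono.word, wmap]

/-- Prepending a creator letter multiplies by the creation matrix. -/
theorem evalMono_consCre (d : α → ι) (c : α) (C A : List α) :
    evalMono d (c :: C, A) = creation (d c) * evalMono d (C, A) := by
  simp [evalMono, Mono.word, wmap, ladderLetter]

/-- With no creators, prepending an annihilator letter multiplies by the annihilation matrix. -/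
theorem evalMono_nil_consAnn (d : α → ι) (a : α) (A : List α) :
    evalMono d (([] : List α), a :: A) = annihilation (d a) * evalMono d (([] : List α), A) := by
  simp [evalMono, Mono.word, wmap, ladderLetter]

/-- Scaling the coefficients scales the operator. -/
theorem evalPoly_map_scale (d : α → ι) (q : ℚ) (P : Poly α) :
    evalPoly d (P.map fun mq => (mq.1, q * mq.2)) = ((q : ℚ) : ℂ) • evalPoly d P := by
  induction P with
  | nil => simp
  | cons mq P ih =>
    rw [List.map_cons, evalPoly_cons, evalPoly_cons, ih, smul_add, Rat.cast_mul, mul_smul]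

/-- A permutation of the term list denotes the same operator. -/
theorem evalPoly_perm (d : α → ι) {P Q : Poly α} (h : P.Perm Q) : evalPoly d P = evalPoly d Q :=
  (h.map _).sum_eq

/-- `emit` is sound. -/
theorem evalPoly_emit (d : α → ι) (m : Mono α) (q : ℚ) (rest : Poly α) :
    evalPoly d (emit m q rest) = ((q : ℚ) : ℂ) • evalMono d m + evalPoly d rest := by
  unfold emit
  split_ifs with h
  · rw [h, Rat.cast_zero, zero_smul, zero_add]
  · rfl

/-- The operator denoted by a polynomial has numerical range bounded below by `constCoeff − l1Nonconst`
per unit norm: every ladder word is a contraction (`isContraction_prod_ladder`), the unit word is `1`. -/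
theorem re_quadForm_evalPoly_ge (d : α → ι) (P : Poly α) (v : Finset ι → ℂ) :
    ((lowerConst P : ℚ) : ℝ) * (star v ⬝ᵥ v).re ≤ (star v ⬝ᵥ (evalPoly d P *ᵥ v)).re := by
  unfold lowerConst
  induction P with
  | nil => simp [constCoeff, l1Nonconst]
  | cons mq P ih =>
    rw [evalPoly_cons, add_mulVec, dotProduct_add, Complex.add_re, Matrix.smul_mulVec, dotProduct_smul,
      smul_eq_mul, constCoeff_cons, l1Nonconst_cons, constPart, l1Part]
    have hq : ((mq.2 : ℚ) : ℂ) = (((mq.2 : ℚ) : ℝ) : ℂ) := (Complex.ofReal_ratCast _).symm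
    by_cases hu : mq.1.isUnit = true
    · rw [if_pos hu, if_pos hu]
      have hm : mq.1 = Mono.unit := (Mono.isUnit_eq_true_iff _).1 hu
      rw [hm, evalMono_unit, one_mulVec, hq, Complex.re_ofReal_mul]
      push_cast at ih ⊢
      linarith
    · rw [if_neg hu, if_neg hu]
      have hc : (evalMono d mq.1).IsContraction := by
        rw [evalMono, ladderWord_eq_prod]
        exact isContraction_prod_ladder _
      have key := hc.neg_norm_mul_le ((mq.2 : ℚ) : ℂ) v
      have hn : ‖((mq.2 : ℚ) : ℂ)‖ = ((|mq.2| : ℚ) : ℝ) := by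
        rw [hq, Complex.norm_real, Real.norm_eq_abs, Rat.cast_abs]
      rw [hn] at key
      push_cast at ih key ⊢
      linarith

end Semantics

/-! ## Soundness of the normal ordering -/

section Soundness

variable {α : Type*} [LinearOrder α] {ι : Type*} [LinearOrder ι] [Fintype ι]

omit [LinearOrder α] in
/-- Consing a creator onto every monomial and negating: `−a†_c · P`. -/
theorem evalPoly_map_negConsCre (d : α → ι) (c : α) (P : Poly α) :
    evalPoly d (P.map fun mq => ((c :: mq.1.1, mq.1.2), -mq.2)) = -(creation (d c) * evalPoly d P) := by
  induction P with
  | nil => simp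
  | cons mq P ih =>
    rw [List.map_cons, evalPoly_cons, evalPoly_cons, ih, Matrix.mul_add, Matrix.mul_smul, neg_add,
      Rat.cast_neg, neg_smul]
    obtain ⟨⟨C, A⟩, q⟩ := mq
    rw [evalMono_consCre]

omit [LinearOrder α] in
/-- Consing an annihilator (no creators) onto every monomial and negating: `−a_a · P` on creator-free terms. -/
theorem evalPoly_map_negConsAnn (d : α → ι) (a : α) (P : Poly α) (hP : ∀ mq ∈ P, mq.1.1 = []) :
    evalPoly d (P.map fun mq => ((([] : List α), a :: mq.1.2), -mq.2)) =
      -(annihilation (d a) * evalPoly d P) := by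
  induction P with
  | nil => simp
  | cons mq P ih =>
    rw [List.map_cons, evalPoly_cons, evalPoly_cons, ih (fun mq' h => hP mq' (List.mem_cons_of_mem _ h)),
      Matrix.mul_add, Matrix.mul_smul, neg_add, Rat.cast_neg, neg_smul, evalMono_nil_consAnn]
    obtain ⟨⟨C, A⟩, q⟩ := mq
    have hC : C = [] := hP _ (List.mem_cons_self)
    subst hC
    rfl

/-- `insAnn` only produces creator-free monomials. -/
theorem insAnn_fst_nil (x : α) : ∀ (A : List α), ∀ mq ∈ insAnn x A, mq.1.1 = []
  | [] => by simp [insAnn]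
  | a :: A => by
    intro mq hmq
    simp only [insAnn] at hmq
    split_ifs at hmq with h1 h2
    · simp only [List.mem_singleton] at hmq
      rw [hmq]
    · simp at hmq
    · obtain ⟨mq', -, rfl⟩ := List.mem_map.1 hmq
      rfl

/-- **Soundness of `prependCre`**: `a†_x · (a†_C a_A)` (creators anticommute, square to zero). -/
theorem evalPoly_prependCre (d : α → ι) (x : α) : ∀ (C A : List α),
    evalPoly d (prependCre x C A) = creation (d x) * evalMono d (C, A)
  | [], A => by
    rw [prependCre, evalPoly_cons, evalPoly_nil, add_zero, Rat.cast_one, one_smul, evalMono_consCre]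
  | c :: C, A => by
    rw [prependCre]
    split_ifs with h1 h2
    · rw [evalPoly_cons, evalPoly_nil, add_zero, Rat.cast_one, one_smul, evalMono_consCre]
    · subst h2
      rw [evalPoly_nil, evalMono_consCre, ← Matrix.mul_assoc, creation_mul_self, Matrix.zero_mul]
    · rw [evalPoly_map_negConsCre, evalPoly_prependCre d x C A, evalMono_consCre, ← Matrix.mul_assoc,
        ← Matrix.mul_assoc, creation_mul_creation_eq_neg (d x) (d c), Matrix.neg_mul]

/-- **Soundness of `insAnn`**: `a_x · (a_A)` (annihilators anticommute, square to zero). -/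
theorem evalPoly_insAnn (d : α → ι) (x : α) : ∀ (A : List α),
    evalPoly d (insAnn x A) = annihilation (d x) * evalMono d (([] : List α), A)
  | [] => by
    rw [insAnn, evalPoly_cons, evalPoly_nil, add_zero, Rat.cast_one, one_smul, evalMono_nil_consAnn]
  | a :: A => by
    rw [insAnn]
    split_ifs with h1 h2
    · rw [evalPoly_cons, evalPoly_nil, add_zero, Rat.cast_one, one_smul, evalMono_nil_consAnn]
    · subst h2
      rw [evalPoly_nil, evalMono_nil_consAnn, ← Matrix.mul_assoc, LiebThm1.annihilation_mul_self, Matrix.zero_mul]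
    · rw [evalPoly_map_negConsAnn d a _ (insAnn_fst_nil x A), evalPoly_insAnn d x A, evalMono_nil_consAnn,
        ← Matrix.mul_assoc, ← Matrix.mul_assoc, LiebThm1.annihilation_mul_annihilation_eq_neg (d x) (d a),
        Matrix.neg_mul]

/-- **Soundness of `prependAnn`** (needs the letter map to be injective: the contraction `a_x a†_c = δ − a†_c a_x`
is decided on letters). -/
theorem evalPoly_prependAnn {d : α → ι} (hd : Function.Injective d) (x : α) : ∀ (C A : List α),
    evalPoly d (prependAnn x C A) = annihilation (d x) * evalMono d (C, A)
  | [], A => by rw [prependAnn, evalPoly_insAnn]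
  | c :: C, A => by
    rw [prependAnn, evalPoly_append, evalPoly_map_negConsCre, evalPoly_prependAnn hd x C A, evalMono_consCre,
      ← Matrix.mul_assoc (annihilation (d x)), annihilation_mul_creation, Matrix.sub_mul, Matrix.mul_assoc,
      sub_eq_add_neg]
    congr 1
    by_cases h : x = c
    · subst h
      rw [if_pos rfl, if_pos rfl, evalPoly_cons, evalPoly_nil, add_zero, Rat.cast_one, one_smul, Matrix.one_mul]
    · rw [if_neg h, if_neg (fun h' => h (hd h')), evalPoly_nil, Matrix.zero_mul]

/-- Soundness of `prependLetter`. -/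
theorem evalPoly_prependLetter {d : α → ι} (hd : Function.Injective d) (l : α × Bool) (m : Mono α) :
    evalPoly d (prependLetter l m) = ladderLetter (d l.1, l.2) * evalMono d m := by
  obtain ⟨x, b⟩ := l
  obtain ⟨C, A⟩ := m
  cases b
  · simp only [prependLetter, ladderLetter, Bool.false_eq_true, if_false]
    exact evalPoly_prependAnn hd x C A
  · simp only [prependLetter, ladderLetter, if_true]
    exact evalPoly_prependCre d x C A

/-- Soundness of `prependLetterPoly`. -/
theorem evalPoly_prependLetterPoly {d : α → ι} (hd : Function.Injective d) (l : α × Bool) (P : Poly α) :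
    evalPoly d (prependLetterPoly l P) = ladderLetter (d l.1, l.2) * evalPoly d P := by
  induction P with
  | nil => simp [prependLetterPoly]
  | cons mq P ih =>
    have h : prependLetterPoly l (mq :: P) =
        ((prependLetter l mq.1).map fun mq' => (mq'.1, mq.2 * mq'.2)) ++ prependLetterPoly l P := rfl
    rw [h, evalPoly_append, ih, evalPoly_map_scale, evalPoly_prependLetter hd, evalPoly_cons, Matrix.mul_add,
      Matrix.mul_smul]

/-- **Soundness of `wordToPoly`**: the normal form denotes the ladder word. -/
theorem evalPoly_wordToPoly {d : α → ι} (hd : Function.Injective d) : ∀ (w : List (α × Bool)),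
    evalPoly d (wordToPoly w) = ladderWord (wmap d w)
  | [] => by
    rw [wordToPoly, evalPoly_cons, evalPoly_nil, add_zero, Rat.cast_one, one_smul, evalMono_unit, wmap_nil,
      ladderWord_nil]
  | l :: w => by
    rw [wordToPoly, evalPoly_prependLetterPoly hd, evalPoly_wordToPoly hd w, wmap_cons, ladderWord_cons]

/-- **Soundness of `termsToPoly`**: the uncollected normal form denotes `Σ_t c_t · ladderWord w_t`. -/
theorem evalPoly_termsToPoly {d : α → ι} (hd : Function.Injective d) (T : List (List (α × Bool) × ℚ)) :
    evalPoly d (termsToPoly T) = (T.map fun wc => ((wc.2 : ℚ) : ℂ) • ladderWord (wmap d wc.1)).sum := by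
  induction T with
  | nil => simp [termsToPoly]
  | cons wc T ih =>
    have h : termsToPoly (wc :: T) =
        ((wordToPoly wc.1).map fun mq => (mq.1, wc.2 * mq.2)) ++ termsToPoly T := rfl
    rw [h, evalPoly_append, ih, evalPoly_map_scale, evalPoly_wordToPoly hd, List.map_cons, List.sum_cons]

/-- Soundness of `mergeAdj`. -/
theorem evalPoly_mergeAdj (d : α → ι) : ∀ (m : Mono α) (q : ℚ) (P : Poly α),
    evalPoly d (mergeAdj m q P) = ((q : ℚ) : ℂ) • evalMono d m + evalPoly d P
  | m, q, [] => by rw [mergeAdj, evalPoly_emit]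
  | m, q, mq :: rest => by
    rw [mergeAdj]
    split_ifs with h
    · rw [evalPoly_mergeAdj d m (qforce (q + mq.2)) rest, qforce_eq, evalPoly_cons, h, Rat.cast_add, add_smul,
        add_assoc]
    · rw [evalPoly_emit, evalPoly_mergeAdj d mq.1 mq.2 rest, evalPoly_cons]

/-- **Soundness of `collect`**: sorting, merging and dropping zeros do not change the operator. -/
theorem evalPoly_collect (d : α → ι) (enc : α → ℕ) (B : ℕ) (P : Poly α) :
    evalPoly d (collect enc B P) = evalPoly d P := by
  have hperm : ((sortByKey (P.map fun mq => (Mono.key enc B mq.1, mq))).map Prod.snd).Perm P := by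
    have h := (sortByKey_perm (P.map fun mq => (Mono.key enc B mq.1, mq))).map Prod.snd
    rw [List.map_map] at h
    have hid : (Prod.snd ∘ fun mq : Mono α × ℚ => (Mono.key enc B mq.1, mq)) = id := rfl
    rw [hid, List.map_id] at h
    exact h
  rw [← evalPoly_perm d hperm]
  unfold collect
  cases hL : (sortByKey (P.map fun mq => (Mono.key enc B mq.1, mq))).map Prod.snd with
  | nil => rfl
  | cons mq rest => rw [evalPoly_mergeAdj, evalPoly_cons]

/-- **Soundness of `normalize`**: the collected normal form of a term list denotes `Σ_t c_t · ladderWord w_t`. -/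
theorem evalPoly_normalize {d : α → ι} (hd : Function.Injective d) (enc : α → ℕ) (B : ℕ)
    (T : List (List (α × Bool) × ℚ)) :
    evalPoly d (normalize enc B T) = (T.map fun wc => ((wc.2 : ℚ) : ℂ) • ladderWord (wmap d wc.1)).sum := by
  rw [normalize, evalPoly_collect, evalPoly_termsToPoly hd]

end Soundness

end CARPoly

end Summit.Ventures.CertifiedQuantumChemistry
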